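import Literature.Topology.FourManifolds.DehnSurgeryFramingProofs
import Literature.AlgebraicTopology.FundamentalGroup.VanKampenPushout
import Literature.AlgebraicTopology.FundamentalGroupoid.SimplyConnectedComplDiscrete
import Mathlib.Analysis.Normed.Module.Ball.Homeomorph
import HarnessLib

/-!
# The fundamental group of an integral Dehn surgery: the knot group modulo the framed longitude

Topic `Literature/Topology/FourManifolds`; written for the fact seat of Property R
(`Literature.Topology.FourManifolds.isUnknot_of_isIntegralSurgery_zero`, `SurgeryGluck.lean`), as
the first step of the classical *Alexander-module obstruction* to Property R (if `0`-surgery on `K`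
is `S² × S¹` then `π₁` of the surgery is `ℤ`, so the commutator subgroup of the knot group is the
normal closure of the longitude, which lies in the second commutator subgroup: the Alexander module
of `K` vanishes).  **Everything in this file is proved; no definition of a `Prop`, no named fact.**

Let `K` be a smooth knot with an oriented tubular neighbourhood `ν : 𝕊¹ × ℝ² ↪ 𝕊³`, and let the
space `Y` be glued from the knot complement `S³ ∖ K` and the open solid torus `D̊² × 𝕊¹` along the
surgery relation of `ν` (`Literature.Topology.FourManifolds.surgeryRel`, `DehnSurgery.lean`): open
embeddings `jA : S³ ∖ K → Y`, `jB : D̊² × 𝕊¹ → Y` with `range jA ∪ range jB = Y` and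
`jA a = jB b ↔ surgeryRel ν a b` — exactly the data of `IsOpenGluing … (surgeryRel ν)` in
`Literature.Topology.FourManifolds.IsIntegralSurgery`, minus smoothness.  Write
`G = π₁(S³ ∖ K, p₀)` (`p₀ = ν.basePoint`) and `λ = [ν.longitude] ∈ G`.

* `Knot.TubularNbhd.map_longitude_eq_one_of_glue` — `jA_* λ = 1`: the longitude is glued onto the
  circle of radius `½` in a meridian disc of the new solid torus, which is convex.
* `Knot.TubularNbhd.ker_map_le_normalClosure_longitude_of_glue` — **`ker jA_* ≤ ⟪λ⟫`**, hence
  `ker jA_* = ⟪λ⟫` (`ker_map_eq_normalClosure_longitude_of_glue`).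
* `Knot.TubularNbhd.map_surjective_of_glue` — **`jA_* : G → π₁(Y, jA p₀)` is onto**.
* `Knot.TubularNbhd.nonempty_mulEquiv_quotient_of_glue` — `π₁(Y, jA p₀) ≃* G ⧸ ⟪λ⟫`, and the
  `IsIntegralSurgery` forms `IsIntegralSurgery.exists_map_surjective_and_ker_eq` (a framing-`m`
  tubular neighbourhood `ν` and the open embedding `jA` with `jA_*` onto and `ker jA_* = ⟪λ⟫`) and
  `IsIntegralSurgery.exists_mulEquiv_quotient_normalClosure_longitude`: if `Y` (Hausdorff) is
  `m`-surgery on `K` then for some tubular neighbourhood `ν` of framing `m`,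
  `π₁(Y, y₀) ≃* π₁(S³ ∖ K, p₀) ⧸ ⟪[ν.longitude]⟫`.

This is the standard presentation "`π₁` of a Dehn filling is `π₁` of the knot exterior with the
filling slope killed" (the solid torus is a `2`-handle `D² × I` plus a `3`-handle; compare Hatcher,
*Algebraic Topology* (2002), Prop. 1.26 for `2`-cells), obtained here directly from the
Seifert–van Kampen theorem for two open sets (Hatcher, Thm. 1.20) in the tree's two proved forms.

## Proof

Remove from `Y` the single point `c = jB (0, b)`, `b = (-1, 0)`, of the core circle of the new
solid torus.  Then `Y ∖ {c} = U ∪ T₁` with `U = jA (S³ ∖ K)` and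
`T₁ = jB (D̊² × (𝕊¹ ∖ {b}))`, a solid torus cut open along one meridian disc.

* *Kernel.*  `U ∩ T₁ = jB ((D̊² ∖ 0) × (𝕊¹ ∖ {b}))` is a punctured disc times an arc, so every loop
  of `U` at `x₀ = jA p₀` inside `T₁` is, back in `S³ ∖ K`, a loop in the tube of `ν` over the whole
  knot whose fibre coordinate avoids the ray through `b`; such loops are powers of the longitude
  (`fromPath_mem_zpowers_longitude`: pull back along `ν` and the angle of the fibre coordinate to a
  loop of `(1/2, 3/2) × (ℂ ∖ 0)` and use `PuncturedPlane.fromPath_mem_zpowers_slice`, exactly as the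
  meridian case `fromPath_mem_zpowers_meridian` of `DehnSurgeryFramingProofs.lean` with the roles of
  the two coordinates of `𝕊¹ × ℝ²` exchanged).  The kernel form of van Kampen's theorem
  (`VanKampen.fromPath_mem_of_homotopic_refl`, `VanKampenKernel.lean`) then puts the class of every
  loop of `U` that is null-homotopic in `Y ∖ {c}` into `⟪λ⟫`; and a loop of `U` null-homotopic in `Y`
  is null-homotopic in `Y ∖ {c}` by general position, `Y` being a `3`-manifold near `c`
  (`FundamentalGroupoid.exists_continuousMap_eqOn_forall_ne`, `SimplyConnectedComplPoint.lean`, with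
  the Euclidean neighbourhood `jB ∘ (chart ball)` of `c`).
* *Surjectivity.*  `π₁(Y ∖ {c}, x₀)` is generated by the images of `π₁(U)` and `π₁(T₁)`
  (Hatcher's Lemma 1.15, `VanKampen.closure_range_inclHom_union_eq_top`), and loops of `T₁` are
  homotopic in `Y ∖ {c}`, fixing `x₀`, into the circle `jB ({½(1,0)} × 𝕊¹) ⊆ U` by the convex
  retraction `(p, v) ↦ ((1 - s) p + s ½(1,0), v)` of the solid torus; finally every loop of `Y` at
  `x₀` can be pushed off `c` (general position again, for paths).
* `λ ∈ ker`: `jA ∘ λ` is the circle `t ↦ jB (½ e^{2πit}, (1,0))`, null-homotopic in the meridian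
  disc `jB (D̊² × {(1,0)})`.

## References

* A. Hatcher, *Algebraic Topology*, CUP (2002), §1.2: Lemma 1.15, Thm. 1.20, Prop. 1.26.
  [HatcherAT2002]
* D. Rolfsen, *Knots and Links* (1976), §9.F–G (integral surgery, longitudes). [Rolfsen1976]
* R. E. Gompf, A. I. Stipsicz, *4-Manifolds and Kirby Calculus* (1999), §5.3. [GompfStipsicz1999]

## Design notes

* The hypotheses on `(jA, jB)` are topological (open embeddings); the smooth `IsOpenGluing` /
  `IsIntegralSurgery` forms are corollaries.  `Y` is only assumed Hausdorff where general position
  is used.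
* The small general-position and chart lemmas (`exists_homotopy_refl_forall_ne`,
  `exists_isOpenEmbedding_apply_zero_eq_sphere_one`, the uniform retract of `[0,1]²`) are
  re-proved here in a few lines rather than importing the heavier general-position files; the
  direction of a fibre vector is the tree's `unitVector` (`GluckTwist.lean`), and the corestriction
  of an open embedding is `FundamentalGroupoid.isOpenEmbedding_codRestrict`.
* The proof-internal plumbing (`longTubeMap`, the punctured cover `puncturedGlue`/`glueU`/`glueT`,
  the identifications `toGlueU`/`ofGlueU`, and the punctured kernel statement) is `private`; the
  public auxiliary data are `dirC` (direction of a complex number), `stPt` (points of the solid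
  torus) and `corePt` (the removed core point), which appear in public statements.
* No definitions of `Prop`s, no named facts, no `sorry`; the theorems depend only on `propext`,
  `Classical.choice`, `Quot.sound`.
-/

noncomputable section

open Complex hiding I
open Set Function unitInterval
open scoped Topology Manifold ContDiff Real
open _root_.Topology (IsOpenEmbedding IsEmbedding)

namespace Literature.Topology.FourManifolds

/-- Local notation: `𝔼 n` is the model Euclidean space `EuclideanSpace ℝ (Fin n)`. -/
local notation "𝔼 " n:arg => EuclideanSpace ℝ (Fin n)

/-- Local notation: `𝕊 n` is the unit sphere in `EuclideanSpace ℝ (Fin (n + 1))`. -/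
local notation "𝕊 " n:arg => (Metric.sphere (0 : EuclideanSpace ℝ (Fin (n + 1))) 1)

open PlaneComplex Literature.AlgebraicTopology.FundamentalGroup

namespace Knot.TubularNbhd

/-! ### Polar coordinates in the fibre `ℝ²` -/

section Fibre

/-- `‖ofC z‖ = ‖z‖`: the identification `ℂ → ℝ²` is norm preserving. [folklore] -/
theorem norm_ofC (z : ℂ) : ‖ofC z‖ = ‖z‖ := by
  rw [← norm_toC (ofC z), toC_ofC]

/-- `‖w‖ • (w / ‖w‖) = w` for the tree's `unitVector w = w / ‖w‖` (`GluckTwist.lean`). [folklore] -/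
theorem norm_smul_unitVector (w : 𝔼 2) (hw : w ≠ 0) : ‖w‖ • (unitVector w hw : 𝔼 2) = w := by
  rw [coe_unitVector, smul_smul, mul_inv_cancel₀ (norm_ne_zero_iff.mpr hw), one_smul]

/-- The unit vector of `t • v`, `t > 0`, `v ∈ 𝕊¹`, is `v`. [folklore] -/
theorem unitVector_smul_coe (v : 𝕊 1) {t : ℝ} (ht : 0 < t) (h : t • (v : 𝔼 2) ≠ 0) :
    unitVector (t • (v : 𝔼 2)) h = v := by
  rw [unitVector_smul ht (v : 𝔼 2) (ne_zero_of_mem_unit_sphere v), unitVector_coe]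

/-- The **direction** `z / ‖z‖ ∈ 𝕊¹ ⊆ ℝ²` of a nonzero complex number. [folklore] -/
def dirC (z : PuncturedPlane.CStar) : 𝕊 1 :=
  ⟨ofC (((‖(z : ℂ)‖⁻¹ : ℝ) : ℂ) * z), by
    rw [mem_sphere_zero_iff_norm, norm_ofC, norm_mul, Complex.norm_real, norm_inv, norm_norm,
      inv_mul_cancel₀ (norm_ne_zero_iff.mpr z.2)]⟩

/-- Value of the complex direction. [folklore] -/
theorem coe_dirC (z : PuncturedPlane.CStar) :
    (dirC z : 𝔼 2) = ofC (((‖(z : ℂ)‖⁻¹ : ℝ) : ℂ) * z) := rfl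

/-- `dirC` is continuous. [folklore] -/
theorem continuous_dirC : Continuous dirC := by
  refine Continuous.subtype_mk (continuous_ofC.comp ?_) _
  exact ((Complex.continuous_ofReal.comp (continuous_subtype_val.norm.inv₀ fun z =>
    norm_ne_zero_iff.mpr z.2)).mul continuous_subtype_val)

/-- The direction of `r · toC u` (`r > 0`, `u ∈ 𝕊¹`) is `u`. [folklore] -/
theorem dirC_real_mul_toC (u : 𝕊 1) {r : ℝ} (hr : 0 < r) (hz : (r : ℂ) * toC (u : 𝔼 2) ≠ 0) :
    dirC ⟨(r : ℂ) * toC (u : 𝔼 2), hz⟩ = u := by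
  apply Subtype.ext
  rw [coe_dirC]
  have hn : ‖(r : ℂ) * toC (u : 𝔼 2)‖ = r := by
    rw [norm_mul, Complex.norm_real, Real.norm_of_nonneg hr.le, norm_toC_sphere, mul_one]
  simp only [hn]
  rw [← mul_assoc, ← Complex.ofReal_mul, inv_mul_cancel₀ hr.ne', Complex.ofReal_one, one_mul, ofC_toC]

/-- The direction of `r e^{iα}` (`r > 0`) is `(cos α, sin α)`. [folklore] -/
theorem dirC_polar {r : ℝ} (hr : 0 < r) (α : ℝ) (hz : (r : ℂ) * exp (α * Complex.I) ≠ 0) :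
    dirC ⟨(r : ℂ) * exp (α * Complex.I), hz⟩ = circlePoint α := by
  apply Subtype.ext
  rw [coe_dirC]
  have hn : ‖(r : ℂ) * exp (α * Complex.I)‖ = r := by
    rw [norm_mul, Complex.norm_real, Real.norm_of_nonneg hr.le, Complex.norm_exp_ofReal_mul_I, mul_one]
  simp only [hn]
  rw [← mul_assoc, ← Complex.ofReal_mul, inv_mul_cancel₀ hr.ne', ofC_polar 1 α, one_smul]

end Fibre

/-! ### Loops in the tube avoiding one fibre ray are powers of the longitude -/

section Slice

variable {K : Knot} (ν : Knot.TubularNbhd K)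

/-- The **longitudinal tube map** `(1/2, 3/2) × (ℂ ∖ 0) → S³ ∖ K`,
`(θ, z) ↦ ν (z / ‖z‖, ‖z‖ · (cos 2πθ, sin 2πθ))`: the modulus and argument of `z` are the radius in
the fibre and the position along the knot, `θ` is the angle in the fibre. It takes values in the
knot complement because the fibre coordinate is nonzero. [folklore] -/
private def longTubeMap : C(angleIoo × PuncturedPlane.CStar, K.complement) where
  toFun a := ⟨ν (dirC a.2, ‖(a.2 : ℂ)‖ • ((circlePt a.1 : 𝕊 1) : 𝔼 2)),
    ν.apply_mem_compl_range (smul_ne_zero (norm_ne_zero_iff.mpr a.2.2) (ne_zero_of_mem_unit_sphere _))⟩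
  continuous_toFun := by
    refine Continuous.subtype_mk (ν.continuous.comp ?_) _
    exact (continuous_dirC.comp continuous_snd).prodMk
      ((continuous_subtype_val.comp continuous_snd).norm.smul
        (continuous_subtype_val.comp (continuous_circlePt.comp
          (continuous_subtype_val.comp continuous_fst))))

/-- Values of the longitudinal tube map. [folklore] -/
private theorem longTubeMap_apply_coe (a : angleIoo × PuncturedPlane.CStar) :
    (ν.longTubeMap a : 𝕊 3) = ν (dirC a.2, ‖(a.2 : ℂ)‖ • ((circlePt a.1 : 𝕊 1) : 𝔼 2)) := rfl

/-- The longitudinal tube map sends `(1, 1/2)` to the base point `p₀ = ν ((1,0), (1/2, 0))`.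
[folklore] -/
private theorem longTubeMap_base :
    ν.longTubeMap (baseAngle, PuncturedPlane.bpt (1 / 2) one_half_pos) = ν.basePoint := by
  apply Subtype.ext
  rw [longTubeMap_apply_coe, coe_basePoint, framingBaseVector, coe_baseAngle, circlePt_one]
  congr 2
  · have h : ((PuncturedPlane.bpt (1 / 2) one_half_pos : PuncturedPlane.CStar) : ℂ) =
        ((1 / 2 : ℝ) : ℂ) * exp ((0 : ℝ) * Complex.I) := by
      rw [PuncturedPlane.bpt_coe]; simp
    have hz : ((1 / 2 : ℝ) : ℂ) * exp ((0 : ℝ) * Complex.I) ≠ 0 := by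
      rw [← h]; exact (PuncturedPlane.bpt (1 / 2) one_half_pos).2
    have := dirC_polar one_half_pos 0 hz
    rw [show (⟨((1 / 2 : ℝ) : ℂ) * exp ((0 : ℝ) * Complex.I), hz⟩ : PuncturedPlane.CStar) =
      PuncturedPlane.bpt (1 / 2) one_half_pos from Subtype.ext h.symm] at this
    rw [this]
  · rw [PuncturedPlane.bpt_coe]
    simp

/-- The longitude is the image of the slice winding loop (radius `1/2`) under the longitudinal
tube map. [folklore] -/
private theorem longitude_eq_longTubeMap (t : I) :
    ν.longitude t = ν.longTubeMap (PuncturedPlane.sliceWindingLoop baseAngle (1 / 2) one_half_pos t) := by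
  apply Subtype.ext
  rw [coe_longitude_apply, longTubeMap_apply_coe, PuncturedPlane.sliceWindingLoop_apply]
  have hw : ((PuncturedPlane.windingLoop (1 / 2) one_half_pos 1 t : PuncturedPlane.CStar) : ℂ) =
      ((1 / 2 : ℝ) : ℂ) * exp (((2 * Real.pi * t : ℝ) : ℂ) * Complex.I) := by
    rw [PuncturedPlane.windingLoop_apply_coe]; push_cast; ring_nf
  have hz : ((1 / 2 : ℝ) : ℂ) * exp (((2 * Real.pi * t : ℝ) : ℂ) * Complex.I) ≠ 0 := by
    rw [← hw]; exact (PuncturedPlane.windingLoop (1 / 2) one_half_pos 1 t).2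
  have hd := dirC_polar one_half_pos (2 * Real.pi * t) hz
  rw [show (⟨((1 / 2 : ℝ) : ℂ) * exp (((2 * Real.pi * t : ℝ) : ℂ) * Complex.I), hz⟩ : PuncturedPlane.CStar) =
    PuncturedPlane.windingLoop (1 / 2) one_half_pos 1 t from Subtype.ext hw.symm] at hd
  rw [hd, hw, coe_baseAngle, circlePt_one, framingBaseVector]
  congr 2
  rw [norm_mul, Complex.norm_real, Complex.norm_exp_ofReal_mul_I, mul_one]
  norm_num

/-- **Loops in the tube whose fibre coordinate avoids one ray are powers of the longitude.**
Every loop of `S³ ∖ K` at `p₀` lying in `ν (𝕊¹ × {w ≠ 0, unitVector w ≠ (-1,0)})` has its class in the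
cyclic subgroup generated by the longitude: pulled back by the embedding `ν` and the angle `angB`
of the fibre direction it is a loop of `(1/2, 3/2) × (ℂ ∖ 0)` (recording the fibre angle, and the
knot coordinate together with the fibre radius as one nonzero complex number), whose class is a
power of the slice winding loop (`PuncturedPlane.fromPath_mem_zpowers_slice`), and the slice winding
loop maps to the longitude. (The meridian analogue is `fromPath_mem_zpowers_meridian`.) [folklore] -/
theorem fromPath_mem_zpowers_longitude (δ : Path ν.basePoint ν.basePoint)
    (hδ : ∀ t, (δ t : 𝕊 3) ∈ ν '' {q | ∃ h : q.2 ≠ 0, unitVector q.2 h ≠ ptB}) :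
    FundamentalGroup.fromPath (Path.Homotopic.Quotient.mk δ) ∈
      Subgroup.zpowers (FundamentalGroup.fromPath (Path.Homotopic.Quotient.mk ν.longitude)) := by
  haveI : SimplyConnectedSpace angleIoo := simplyConnectedSpace_angleIoo
  have hr : (0 : ℝ) < 1 / 2 := one_half_pos
  -- pull the loop back to `S¹ × ℝ²` through the embedding `ν`
  let eν := ν.isSmoothEmbedding_coe.isEmbedding.toHomeomorph
  have hδr : ∀ t, (δ t : 𝕊 3) ∈ range ν := fun t => image_subset_range _ _ (hδ t)
  let q : I → (𝕊 1) × 𝔼 2 := fun t => eν.symm ⟨(δ t : 𝕊 3), hδr t⟩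
  have hq : Continuous q :=
    eν.symm.continuous.comp ((continuous_subtype_val.comp δ.continuous).subtype_mk _)
  have hνq : ∀ t, ν (q t) = δ t := fun t => by
    have h := congrArg Subtype.val (eν.apply_symm_apply ⟨(δ t : 𝕊 3), hδr t⟩)
    rwa [IsEmbedding.toHomeomorph_apply_coe] at h
  have hq2 : ∀ t, (q t).2 ≠ 0 := fun t h0 => by
    obtain ⟨p, ⟨hp, -⟩, hpt⟩ := hδ t
    have : p = q t := ν.injective (hpt.trans (hνq t).symm)
    exact hp (this ▸ h0)
  have hqB : ∀ t, unitVector (q t).2 (hq2 t) ≠ ptB := fun t h1 => by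
    obtain ⟨p, ⟨hp, hpB⟩, hpt⟩ := hδ t
    have : p = q t := ν.injective (hpt.trans (hνq t).symm)
    subst this
    exact hpB h1
  have hbase : ∀ t, (δ t : 𝕊 3) = ν (circlePoint 0, framingBaseVector) →
      q t = (circlePoint 0, framingBaseVector) := fun t ht => by
    change eν.symm ⟨(δ t : 𝕊 3), hδr t⟩ = _
    have : (⟨(δ t : 𝕊 3), hδr t⟩ : range ν) = ⟨ν (circlePoint 0, framingBaseVector), ⟨_, rfl⟩⟩ :=
      Subtype.ext ht
    rw [this]
    exact IsEmbedding.toHomeomorph_symm_apply _ _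
  have hq0 : q 0 = (circlePoint 0, framingBaseVector) := hbase 0 (by rw [δ.source]; rfl)
  have hq1 : q 1 = (circlePoint 0, framingBaseVector) := hbase 1 (by rw [δ.target]; rfl)
  -- the direction of the base fibre vector is `ptA = circlePoint 0`
  have hdir0 : ∀ h : framingBaseVector ≠ 0, unitVector framingBaseVector h = circlePoint 0 := fun h =>
    unitVector_smul_coe (circlePoint 0) hr h
  -- the angle coordinate (fibre direction)
  let θ : I → ℝ := fun t => angB (unitVector (q t).2 (hq2 t))
  have hdirc : Continuous fun t => (unitVector (q t).2 (hq2 t) : 𝕊 1) := by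
    refine Continuous.subtype_mk ?_ _
    exact ((continuous_snd.comp hq).norm.inv₀ fun t => norm_ne_zero_iff.mpr (hq2 t)).smul
      (continuous_snd.comp hq)
  have hθ : Continuous θ :=
    continuous_iff_continuousAt.2 fun t =>
      ContinuousAt.comp (g := angB) (f := fun t => unitVector (q t).2 (hq2 t)) (x := t)
        (continuousAt_angB (hqB t)) hdirc.continuousAt
  have hθmem : ∀ t, θ t ∈ angleIoo := fun t => angB_mem_Ioo (hqB t)
  -- the complex coordinate (knot position and fibre radius)
  let z : I → ℂ := fun t => ((‖(q t).2‖ : ℝ) : ℂ) * toC ((q t).1 : 𝔼 2)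
  have hz : Continuous z :=
    (Complex.continuous_ofReal.comp (continuous_snd.comp hq).norm).mul
      (continuous_toC.comp (continuous_subtype_val.comp (continuous_fst.comp hq)))
  have hz0 : ∀ t, z t ≠ 0 := fun t =>
    mul_ne_zero (Complex.ofReal_ne_zero.2 (norm_ne_zero_iff.mpr (hq2 t))) (toC_sphere_ne_zero _)
  -- the loop in `(1/2, 3/2) × (ℂ ∖ 0)`
  let b : angleIoo × PuncturedPlane.CStar := (baseAngle, PuncturedPlane.bpt (1 / 2) hr)
  have hzbase : ∀ t, q t = (circlePoint 0, framingBaseVector) → z t = ((1 / 2 : ℝ) : ℂ) := fun t ht => by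
    change ((‖(q t).2‖ : ℝ) : ℂ) * toC ((q t).1 : 𝔼 2) = _
    rw [ht]
    change ((‖framingBaseVector‖ : ℝ) : ℂ) * toC ((circlePoint 0 : 𝕊 1) : 𝔼 2) = _
    have hn : ‖framingBaseVector‖ = 1 / 2 := by
      rw [show framingBaseVector = (1 / 2 : ℝ) • ((circlePoint 0 : 𝕊 1) : 𝔼 2) from rfl, norm_smul,
        norm_eq_of_mem_sphere, mul_one, Real.norm_of_nonneg hr.le]
    have ht : toC ((circlePoint 0 : 𝕊 1) : 𝔼 2) = 1 := by rw [circlePoint_zero_eq_ptA, toC_ptA]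
    rw [hn, ht, mul_one]
  let δA : Path b b :=
    { toFun := fun t => (⟨θ t, hθmem t⟩, ⟨z t, hz0 t⟩)
      continuous_toFun := (hθ.subtype_mk _).prodMk (hz.subtype_mk _)
      source' := by
        refine Prod.ext (Subtype.ext ?_) (Subtype.ext ?_)
        · change angB (unitVector (q 0).2 (hq2 0)) = 1
          have h2 : (q 0).2 = framingBaseVector := by rw [hq0]
          simp only [h2]
          rw [hdir0, angB_circlePoint_zero]
        · change z 0 = ((1 / 2 : ℝ) : ℂ)
          exact hzbase 0 hq0
      target' := by
        refine Prod.ext (Subtype.ext ?_) (Subtype.ext ?_)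
        · change angB (unitVector (q 1).2 (hq2 1)) = 1
          have h2 : (q 1).2 = framingBaseVector := by rw [hq1]
          simp only [h2]
          rw [hdir0, angB_circlePoint_zero]
        · change z 1 = ((1 / 2 : ℝ) : ℂ)
          exact hzbase 1 hq1 }
  have hδA : ∀ t, δ t = ν.longTubeMap (δA t) := fun t => by
    apply Subtype.ext
    change (δ t : 𝕊 3) = ν (dirC ⟨z t, hz0 t⟩, ‖z t‖ • ((circlePt (angB (unitVector (q t).2 (hq2 t))) : 𝕊 1) : 𝔼 2))
    rw [circlePt_angB]
    have h1 : dirC ⟨z t, hz0 t⟩ = (q t).1 :=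
      dirC_real_mul_toC _ (norm_pos_iff.mpr (hq2 t)) (hz0 t)
    have h2 : ‖z t‖ = ‖(q t).2‖ := by
      change ‖((‖(q t).2‖ : ℝ) : ℂ) * toC ((q t).1 : 𝔼 2)‖ = _
      rw [norm_mul, Complex.norm_real, norm_norm, norm_toC_sphere, mul_one]
    rw [h1, h2, norm_smul_unitVector, Prod.mk.eta, hνq]
  have hb : ν.longTubeMap b = ν.basePoint := ν.longTubeMap_base
  have e1 := FundamentalGroup.mapOfEq_fromPath_eq ν.longTubeMap hb δA δ hδA
  have e2 := FundamentalGroup.mapOfEq_fromPath_eq ν.longTubeMap hb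
    (PuncturedPlane.sliceWindingLoop baseAngle (1 / 2) hr) ν.longitude ν.longitude_eq_longTubeMap
  obtain ⟨k, hk⟩ := Subgroup.mem_zpowers_iff.1
    (PuncturedPlane.fromPath_mem_zpowers_slice baseAngle (1 / 2) hr δA)
  rw [← e1, ← hk, map_zpow, e2]
  exact Subgroup.zpow_mem _ (Subgroup.mem_zpowers _) k

end Slice


/-! ### The glued space: elementary consequences of the surgery relation -/

section Glue

variable {K : Knot} (ν : Knot.TubularNbhd K)
variable {Y : Type*} {jA : K.complement → Y} {jB : solidTorus → Y}

/-- The point `(p, v)` of the open solid torus, `‖p‖ < 1`. [folklore] -/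
def stPt (p : 𝔼 2) (v : 𝕊 1) (hp : ‖p‖ < 1) : solidTorus :=
  ⟨(p, v), (mem_solidTorus_iff _).2 hp⟩

/-- Coordinates of `stPt`. [folklore] -/
@[simp] theorem coe_stPt (p : 𝔼 2) (v : 𝕊 1) (hp : ‖p‖ < 1) :
    (stPt p v hp : (𝔼 2) × (𝕊 1)) = (p, v) := rfl

/-- Every point of the solid torus is an `stPt`. [folklore] -/
theorem stPt_eta (b : solidTorus) :
    stPt (b : (𝔼 2) × (𝕊 1)).1 (b : (𝔼 2) × (𝕊 1)).2 ((mem_solidTorus_iff _).1 b.2) = b :=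
  Subtype.ext rfl

/-- `‖t • u‖ < 1` for `t ∈ (0, 1)` and a unit vector `u`. [folklore] -/
theorem norm_smul_coe_lt_one (u : 𝕊 1) {t : ℝ} (ht : t ∈ Ioo (0 : ℝ) 1) : ‖t • (u : 𝔼 2)‖ < 1 := by
  rw [norm_smul, norm_eq_of_mem_sphere u, mul_one, Real.norm_of_nonneg ht.1.le]; exact ht.2

/-- **The surgery gluing, pointwise**: `jA (ν (u, t v)) = jB (t u, v)` for `u, v ∈ 𝕊¹`,
`0 < t < 1`. [folklore] -/
theorem glue_apply (hR : ∀ a b, jA a = jB b ↔ surgeryRel ν a b) (u v : 𝕊 1) {t : ℝ}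
    (ht : t ∈ Ioo (0 : ℝ) 1) :
    jA ⟨ν (u, t • (v : 𝔼 2)), ν.apply_mem_compl_range
        (smul_ne_zero ht.1.ne' (ne_zero_of_mem_unit_sphere v))⟩ =
      jB (stPt (t • (u : 𝔼 2)) v (norm_smul_coe_lt_one u ht)) :=
  (hR _ _).2 ⟨u, t, ht, rfl, rfl⟩

/-- If `jA a = jB b` then `b = (t u, v)` and `a = ν (u, t v)` with `0 < t < 1`. [folklore] -/
theorem exists_of_glue_eq (hR : ∀ a b, jA a = jB b ↔ surgeryRel ν a b) {a : K.complement}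
    {b : solidTorus} (h : jA a = jB b) :
    ∃ (u : 𝕊 1) (t : ℝ), t ∈ Ioo (0 : ℝ) 1 ∧ (b : (𝔼 2) × (𝕊 1)).1 = t • (u : 𝔼 2) ∧
      (a : 𝕊 3) = ν (u, t • ((b : (𝔼 2) × (𝕊 1)).2 : 𝔼 2)) :=
  (hR a b).1 h

/-- A point of the solid torus off the core circle is glued to a point of the knot complement:
`jB (p, v) = jA (ν (p/‖p‖, ‖p‖ v))` for `0 < ‖p‖ < 1`. [folklore] -/
theorem jB_mem_range_jA (hR : ∀ a b, jA a = jB b ↔ surgeryRel ν a b) (b : solidTorus)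
    (hb : (b : (𝔼 2) × (𝕊 1)).1 ≠ 0) : jB b ∈ range jA := by
  set p := (b : (𝔼 2) × (𝕊 1)).1 with hp
  have hlt : ‖p‖ < 1 := (mem_solidTorus_iff _).1 b.2
  have ht : ‖p‖ ∈ Ioo (0 : ℝ) 1 := ⟨norm_pos_iff.mpr hb, hlt⟩
  refine ⟨_, (ν.glue_apply hR (unitVector p hb) (b : (𝔼 2) × (𝕊 1)).2 ht).trans ?_⟩
  congr 1
  rw [← stPt_eta b]
  exact Subtype.ext (Prod.ext (norm_smul_unitVector p hb) rfl)

/-- The overlap of the two pieces of the surgery gluing is the image of the punctured solid torus.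
[folklore] -/
theorem range_jA_inter_range_jB (hR : ∀ a b, jA a = jB b ↔ surgeryRel ν a b) :
    range jA ∩ range jB = jB '' {b : solidTorus | (b : (𝔼 2) × (𝕊 1)).1 ≠ 0} := by
  ext y
  constructor
  · rintro ⟨⟨a, ha⟩, ⟨bb, rfl⟩⟩
    obtain ⟨u, t, ht, hb1, -⟩ := ν.exists_of_glue_eq hR ha
    exact ⟨bb, by rw [mem_setOf_eq, hb1]; exact smul_ne_zero ht.1.ne' (ne_zero_of_mem_unit_sphere u), rfl⟩
  · rintro ⟨bb, hb0, rfl⟩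
    exact ⟨ν.jB_mem_range_jA hR bb hb0, bb, rfl⟩

/-- The **core point** `c = jB (0, (-1, 0))` removed in the van Kampen argument. [folklore] -/
def corePt (jB : solidTorus → Y) : Y := jB (stPt 0 ptB (by simp))

/-- The core point is not glued to the knot complement. [folklore] -/
theorem corePt_notMem_range_jA (hR : ∀ a b, jA a = jB b ↔ surgeryRel ν a b) :
    corePt jB ∉ range jA := by
  rintro ⟨a, ha⟩
  obtain ⟨u, t, ht, hb, -⟩ := ν.exists_of_glue_eq hR ha
  have : t • (u : 𝔼 2) = 0 := by rw [← hb]; rfl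
  exact smul_ne_zero ht.1.ne' (ne_zero_of_mem_unit_sphere u) this

/-- A point of the solid torus other than `(0, (-1,0))` has nonzero disc coordinate or knot
coordinate `≠ (-1, 0)`. [folklore] -/
theorem fst_ne_zero_or_snd_ne_ptB {b : solidTorus} (hb : jB b ≠ corePt jB) :
    (b : (𝔼 2) × (𝕊 1)).1 ≠ 0 ∨ (b : (𝔼 2) × (𝕊 1)).2 ≠ ptB := by
  by_cases h1 : (b : (𝔼 2) × (𝕊 1)).1 = 0
  · refine Or.inr fun h2 => hb ?_
    unfold corePt
    congr 1
    rw [← stPt_eta b]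
    exact Subtype.ext (Prod.ext h1 h2)
  · exact Or.inl h1

/-- The base point `p₀ = ν ((1,0), ½(1,0))` is glued to `(½(1,0), (1,0))`. [folklore] -/
theorem jA_basePoint (hR : ∀ a b, jA a = jB b ↔ surgeryRel ν a b) :
    jA ν.basePoint = jB (stPt framingBaseVector ptA (by
      rw [show framingBaseVector = (1 / 2 : ℝ) • ((circlePoint 0 : 𝕊 1) : 𝔼 2) from rfl]
      exact norm_smul_coe_lt_one _ ⟨by norm_num, by norm_num⟩)) := by
  have h := ν.glue_apply hR (circlePoint 0) (circlePoint 0) (t := 1 / 2) ⟨by norm_num, by norm_num⟩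
  have hb : ν.basePoint = ⟨ν (circlePoint 0, (1 / 2 : ℝ) • ((circlePoint 0 : 𝕊 1) : 𝔼 2)),
      ν.apply_mem_compl_range (smul_ne_zero (by norm_num) (ne_zero_of_mem_unit_sphere _))⟩ :=
    Subtype.ext rfl
  rw [hb, h]
  congr 1
  exact Subtype.ext (Prod.ext rfl circlePoint_zero_eq_ptA)

/-- Points of the knot complement map into `Y ∖ {c}`. [folklore] -/
theorem jA_ne_corePt (hR : ∀ a b, jA a = jB b ↔ surgeryRel ν a b) (x : K.complement) :
    jA x ≠ corePt jB := fun h =>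
  ν.corePt_notMem_range_jA hR ⟨x, h⟩

end Glue

/-! ### The kernel of `π₁(S³ ∖ K) → π₁(Y ∖ c)` (van Kampen, kernel form) -/

section Kernel

variable {K : Knot} (ν : Knot.TubularNbhd K)
variable {Y : Type*} [TopologicalSpace Y] {jA : K.complement → Y} {jB : solidTorus → Y}

/-- The punctured glued space `Y ∖ {c}`. [folklore] -/
private abbrev puncturedGlue (jB : solidTorus → Y) : Set Y := {corePt jB}ᶜ

/-- The copy `U` of the knot complement inside `Y ∖ {c}`. [folklore] -/
private abbrev glueU (jA : K.complement → Y) (jB : solidTorus → Y) : Set (puncturedGlue jB) :=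
  {y | (y : Y) ∈ range jA}

/-- The cut solid torus `T₁ = jB (D̊² × (𝕊¹ ∖ {(-1,0)}))` inside `Y ∖ {c}`. [folklore] -/
private abbrev glueT (jB : solidTorus → Y) : Set (puncturedGlue jB) :=
  {y | (y : Y) ∈ jB '' {b | (b : (𝔼 2) × (𝕊 1)).2 ≠ ptB}}

/-- The identification `φ` of the knot complement with `U ⊆ Y ∖ {c}`. [folklore] -/
private def toGlueU (hR : ∀ a b, jA a = jB b ↔ surgeryRel ν a b) (hA : IsOpenEmbedding jA) :
    C(K.complement, glueU jA jB) where
  toFun x := ⟨⟨jA x, ν.jA_ne_corePt hR x⟩, ⟨x, rfl⟩⟩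
  continuous_toFun := ((hA.continuous.subtype_mk _).subtype_mk _)

/-- The inverse identification `ψ : U → S³ ∖ K`. [folklore] -/
private def ofGlueU (hA : IsOpenEmbedding jA) : C(glueU jA jB, K.complement) where
  toFun y := hA.isEmbedding.toHomeomorph.symm ⟨(y : puncturedGlue jB), y.2⟩
  continuous_toFun := hA.isEmbedding.toHomeomorph.symm.continuous.comp
    ((continuous_subtype_val.comp continuous_subtype_val).subtype_mk _)

/-- `ψ ∘ φ = id`. [folklore] -/
private theorem ofGlueU_toGlueU (hR : ∀ a b, jA a = jB b ↔ surgeryRel ν a b) (hA : IsOpenEmbedding jA)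
    (x : K.complement) : ofGlueU (jB := jB) hA (ν.toGlueU hR hA x) = x :=
  IsEmbedding.toHomeomorph_symm_apply _ _

/-- `jA ∘ ψ` is the inclusion. [folklore] -/
private theorem jA_ofGlueU (hA : IsOpenEmbedding jA) (y : glueU jA jB) :
    jA (ofGlueU hA y) = ((y : puncturedGlue jB) : Y) := by
  have h := congrArg Subtype.val
    (hA.isEmbedding.toHomeomorph.apply_symm_apply ⟨((y : puncturedGlue jB) : Y), y.2⟩)
  rwa [IsEmbedding.toHomeomorph_apply_coe] at h

/-- `φ ∘ ψ = id`. [folklore] -/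
private theorem toGlueU_ofGlueU (hR : ∀ a b, jA a = jB b ↔ surgeryRel ν a b) (hA : IsOpenEmbedding jA)
    (y : glueU jA jB) : ν.toGlueU hR hA (ofGlueU hA y) = y :=
  Subtype.ext (Subtype.ext (jA_ofGlueU hA y))

/-- `(1/2, 3/2) × (0, 1) × … ` style parametrisation of the cut, punctured solid torus: the map
`(r, θ, v) ↦ (r (cos 2πθ, sin 2πθ), v)` on the set `{0 < r < 1}`. Its image of
`(0,1) × ℝ × S` is `{(p, v) | p ≠ 0, v ∈ S}`, which is therefore path connected when `S` is.
[folklore] -/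
theorem isPathConnected_solidTorus_setOf {S : Set (𝕊 1)} (hS : IsPathConnected S) :
    IsPathConnected {b : solidTorus | (b : (𝔼 2) × (𝕊 1)).1 ≠ 0 ∧ (b : (𝔼 2) × (𝕊 1)).2 ∈ S} := by
  let P : Set (ℝ × ℝ × (𝕊 1)) := Ioo (0 : ℝ) 1 ×ˢ (univ ×ˢ S)
  have hP : IsPathConnected P :=
    ((convex_Ioo (0 : ℝ) 1).isPathConnected ⟨1 / 2, by norm_num, by norm_num⟩).prod
      (isPathConnected_univ.prod hS)
  haveI : PathConnectedSpace P := (isPathConnected_iff_pathConnectedSpace).1 hP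
  let F : P → solidTorus := fun x =>
    stPt ((x : ℝ × ℝ × (𝕊 1)).1 • ((circlePt (x : ℝ × ℝ × (𝕊 1)).2.1 : 𝕊 1) : 𝔼 2))
      (x : ℝ × ℝ × (𝕊 1)).2.2 (norm_smul_coe_lt_one _ x.2.1)
  have hF : Continuous F := by
    refine Continuous.subtype_mk (Continuous.prodMk ?_ ?_) _
    · exact (continuous_fst.comp continuous_subtype_val).smul
        (continuous_subtype_val.comp (continuous_circlePt.comp
          (continuous_fst.comp (continuous_snd.comp continuous_subtype_val))))
    · exact continuous_snd.comp (continuous_snd.comp continuous_subtype_val)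
  have hrange : range F = {b : solidTorus | (b : (𝔼 2) × (𝕊 1)).1 ≠ 0 ∧ (b : (𝔼 2) × (𝕊 1)).2 ∈ S} := by
    ext b
    constructor
    · rintro ⟨x, rfl⟩
      exact ⟨smul_ne_zero x.2.1.1.ne' (ne_zero_of_mem_unit_sphere _), x.2.2.2⟩
    · rintro ⟨hb0, hbS⟩
      have hlt : ‖(b : (𝔼 2) × (𝕊 1)).1‖ < 1 := (mem_solidTorus_iff _).1 b.2
      have hmem : (‖(b : (𝔼 2) × (𝕊 1)).1‖, angB (unitVector _ hb0), (b : (𝔼 2) × (𝕊 1)).2) ∈ P :=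
        Set.mk_mem_prod (Set.mem_Ioo.2 ⟨norm_pos_iff.mpr hb0, hlt⟩) (Set.mk_mem_prod (mem_univ _) hbS)
      refine ⟨⟨_, hmem⟩, ?_⟩
      apply Subtype.ext
      change ((‖(b : (𝔼 2) × (𝕊 1)).1‖ • ((circlePt (angB (unitVector _ hb0)) : 𝕊 1) : 𝔼 2)),
        (b : (𝔼 2) × (𝕊 1)).2) = (b : (𝔼 2) × (𝕊 1))
      rw [circlePt_angB, norm_smul_unitVector]
  rw [← hrange]
  exact isPathConnected_range hF

/-- The circle minus the point `(-1, 0)` is path connected (an open arc). [folklore] -/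
theorem isPathConnected_compl_ptB : IsPathConnected ({ptB}ᶜ : Set (𝕊 1)) := by
  rw [compl_ptB_eq_image]
  exact ((convex_Ioo _ _).isPathConnected ⟨1, by norm_num, by norm_num⟩).image continuous_circlePt

/-- **Kernel form of van Kampen for the punctured surgery.** Every loop `γ` of `S³ ∖ K` at `p₀`
whose image `jA ∘ γ` is null-homotopic in the punctured glued space `Y ∖ {c}` has its class in the
normal closure of the longitude. (Cover `Y ∖ {c} = U ∪ T₁`; loops of `U` inside `T₁` are powers of
the longitude by `fromPath_mem_zpowers_longitude`; `VanKampen.fromPath_mem_of_homotopic_refl`.)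
[cite: HatcherAT2002, Thm. 1.20] -/
private theorem fromPath_mem_normalClosure_longitude_of_homotopic_punctured
    (hR : ∀ a b, jA a = jB b ↔ surgeryRel ν a b) (hcov : range jA ∪ range jB = univ)
    (hA : IsOpenEmbedding jA) (hB : IsOpenEmbedding jB) (γ : Path ν.basePoint ν.basePoint)
    (hγ : ((γ.map (ν.toGlueU hR hA).continuous).map continuous_subtype_val).Homotopic
      (Path.refl _)) :
    FundamentalGroup.fromPath (Path.Homotopic.Quotient.mk γ) ∈
      Subgroup.normalClosure
        {(FundamentalGroup.fromPath (Path.Homotopic.Quotient.mk ν.longitude) :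
          FundamentalGroup K.complement ν.basePoint)} := by
  -- notation
  let Y₁ : Set Y := puncturedGlue jB
  let U : Set Y₁ := glueU jA jB
  let T : Set Y₁ := glueT jB
  let φ : C(K.complement, U) := ν.toGlueU hR hA
  let ψ : C(U, K.complement) := ofGlueU (jB := jB) hA
  let b : K.complement := ν.basePoint
  let ℓ : FundamentalGroup K.complement b :=
    FundamentalGroup.fromPath (Path.Homotopic.Quotient.mk ν.longitude)
  let x₀ : Y₁ := (φ b : U)
  have hxU : x₀ ∈ U := (φ b).2
  have hψφ : ∀ x : K.complement, ψ (φ x) = x := ν.ofGlueU_toGlueU hR hA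
  have hφψ : ∀ y : U, φ (ψ y) = y := ν.toGlueU_ofGlueU hR hA
  -- openness
  have hUo : IsOpen U := hA.isOpen_range.preimage continuous_subtype_val
  have hTo : IsOpen T := by
    refine (hB.isOpenMap _ ?_).preimage continuous_subtype_val
    exact isOpen_compl_singleton.preimage (continuous_snd.comp continuous_subtype_val)
  -- the cover
  have hUT : U ∪ T = univ := by
    refine eq_univ_of_forall fun y => ?_
    have hy : (y : Y) ∈ range jA ∪ range jB := by rw [hcov]; exact mem_univ _
    rcases hy with hy | ⟨bb, hbb⟩
    · exact Or.inl hy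
    · rcases fst_ne_zero_or_snd_ne_ptB (jB := jB) (b := bb) (by rw [hbb]; exact y.2) with h | h
      · left
        change (y : Y) ∈ range jA
        rw [← hbb]
        exact ν.jB_mem_range_jA hR bb h
      · exact Or.inr ⟨bb, h, hbb⟩
  -- path connectedness of the pieces
  have hval : _root_.Topology.IsInducing (Subtype.val : Y₁ → Y) := .subtypeVal
  haveI : PathConnectedSpace K.complement := ν.pathConnectedSpace_complement
  have hUpc : IsPathConnected U := by
    rw [hval.isPathConnected_iff]
    have : Subtype.val '' U = range jA := by
      rw [show U = Subtype.val ⁻¹' (range jA) from rfl, Subtype.image_preimage_coe, inter_eq_right]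
      rintro _ ⟨x, rfl⟩
      exact ν.jA_ne_corePt hR x
    rw [this]
    exact isPathConnected_range hA.continuous
  have hmeet : IsPathConnected (U ∩ T) := by
    rw [hval.isPathConnected_iff]
    have : Subtype.val '' (U ∩ T) =
        jB '' {bb : solidTorus | (bb : (𝔼 2) × (𝕊 1)).1 ≠ 0 ∧ (bb : (𝔼 2) × (𝕊 1)).2 ∈ ({ptB}ᶜ : Set (𝕊 1))} := by
      rw [show U ∩ T = Subtype.val ⁻¹'
          (range jA ∩ jB '' {bb : solidTorus | (bb : (𝔼 2) × (𝕊 1)).2 ≠ ptB}) from rfl,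
        Subtype.image_preimage_coe]
      ext y
      constructor
      · rintro ⟨-, ⟨a, ha⟩, ⟨bb, hbB, rfl⟩⟩
        obtain ⟨u, t, ht, hb1, -⟩ := ν.exists_of_glue_eq hR ha
        exact ⟨bb, ⟨by rw [hb1]; exact smul_ne_zero ht.1.ne' (ne_zero_of_mem_unit_sphere u), hbB⟩, rfl⟩
      · rintro ⟨bb, ⟨hb0, hbB⟩, rfl⟩
        refine ⟨?_, ν.jB_mem_range_jA hR bb hb0, ⟨bb, hbB, rfl⟩⟩
        intro h
        have hbb : bb = stPt 0 ptB (by simp) := hB.injective (mem_singleton_iff.1 h)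
        exact hb0 (by rw [hbb]; rfl)
    rw [this]
    exact (isPathConnected_solidTorus_setOf isPathConnected_compl_ptB).image hB.continuous
  -- the base point lies in the cut solid torus
  have hxT : x₀ ∈ T := by
    change jA ν.basePoint ∈ jB '' {bb : solidTorus | (bb : (𝔼 2) × (𝕊 1)).2 ≠ ptB}
    rw [ν.jA_basePoint hR]
    exact ⟨_, ptA_ne_ptB, rfl⟩
  -- the normal closure of the transported longitude
  let ℓ' : FundamentalGroup U (φ b) :=
    FundamentalGroup.fromPath (Path.Homotopic.Quotient.mk (ν.longitude.map φ.continuous))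
  let N : Subgroup (FundamentalGroup U (φ b)) := Subgroup.normalClosure {ℓ'}
  haveI hN : N.Normal := Subgroup.normalClosure_normal
  -- loops of `U` inside the cut solid torus are powers of the transported longitude
  have hNT : ∀ δ' : Path (φ b) (φ b), (∀ t, ((δ' t : U) : Y₁) ∈ T) →
      FundamentalGroup.fromPath (Path.Homotopic.Quotient.mk δ') ∈ N := by
    intro δ' hδ'
    let δ : Path b b := (δ'.map ψ.continuous).cast (hψφ b).symm (hψφ b).symm
    have hδ : ∀ t, (δ t : 𝕊 3) ∈ ν '' {q | ∃ h : q.2 ≠ 0, unitVector q.2 h ≠ ptB} := fun t => by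
      obtain ⟨bb, hbB, hbb⟩ := hδ' t
      have ha : jA (ψ (δ' t)) = jB bb := (jA_ofGlueU hA (δ' t)).trans hbb.symm
      obtain ⟨u, s, hs, -, hq⟩ := ν.exists_of_glue_eq hR ha
      refine ⟨(u, s • ((bb : (𝔼 2) × (𝕊 1)).2 : 𝔼 2)), ⟨smul_ne_zero hs.1.ne' (ne_zero_of_mem_unit_sphere _), ?_⟩, hq.symm⟩
      rw [unitVector_smul_coe _ hs.1]
      exact hbB
    have hmem := ν.fromPath_mem_zpowers_longitude δ hδ
    obtain ⟨k, hk⟩ := Subgroup.mem_zpowers_iff.1 hmem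
    have e1 := FundamentalGroup.mapOfEq_fromPath_eq φ (rfl : φ b = φ b) δ δ' fun t =>
      (hφψ (δ' t)).symm
    have e2 := FundamentalGroup.mapOfEq_fromPath_eq φ (rfl : φ b = φ b) ν.longitude
      (ν.longitude.map φ.continuous) fun t => rfl
    rw [← e1, ← hk, map_zpow, e2]
    exact Subgroup.zpow_mem _ (Subgroup.subset_normalClosure (mem_singleton _)) k
  -- van Kampen: the class of our loop lies in `N`
  have hall : FundamentalGroup.fromPath (Path.Homotopic.Quotient.mk (γ.map φ.continuous)) ∈ N :=
    VanKampen.fromPath_mem_of_homotopic_refl (Y := Y₁) (U := U) (T := T) hUo hTo hUT hUpc hmeet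
      hxU hxT N hNT (γ.map φ.continuous) hγ
  -- transfer back to the knot complement along `ψ`
  let ψs : FundamentalGroup U (φ b) →* FundamentalGroup K.complement b :=
    FundamentalGroup.mapOfEq ψ (hψφ b)
  have e3 : ψs (FundamentalGroup.fromPath (Path.Homotopic.Quotient.mk (γ.map φ.continuous))) =
      FundamentalGroup.fromPath (Path.Homotopic.Quotient.mk γ) :=
    FundamentalGroup.mapOfEq_fromPath_eq ψ (hψφ b) (γ.map φ.continuous) γ fun t => (hψφ (γ t)).symm
  have e4 : ψs ℓ' = ℓ :=
    FundamentalGroup.mapOfEq_fromPath_eq ψ (hψφ b) (ν.longitude.map φ.continuous) ν.longitude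
      fun t => (hψφ (ν.longitude t)).symm
  rw [← e3]
  have hle : N.map ψs ≤ Subgroup.normalClosure {ℓ} := by
    rw [Subgroup.map_le_iff_le_comap]
    haveI : ((Subgroup.normalClosure {ℓ}).comap ψs).Normal := Subgroup.Normal.comap inferInstance _
    refine Subgroup.normalClosure_le_normal ?_
    rintro _ rfl
    rw [SetLike.mem_coe, Subgroup.mem_comap, e4]
    exact Subgroup.subset_normalClosure (mem_singleton _)
  exact hle (Subgroup.mem_map_of_mem _ hall)

end Kernel

/-! ### General position: null-homotopies and the core point -/

section GeneralPosition

/-- `[0,1]²` is a uniform retract of `ℝ²`, of dimension `2` (as in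
`GeneralPositionManifold.retract_unitSquare'`). [folklore] -/
private theorem retract_unitSquare'' :
    Continuous (fun x : I × I => ((x.1 : ℝ), (x.2 : ℝ))) ∧
      UniformContinuous (fun y : ℝ × ℝ =>
        (projIcc (0 : ℝ) 1 zero_le_one y.1, projIcc (0 : ℝ) 1 zero_le_one y.2)) ∧
      (∀ x : I × I, (projIcc (0 : ℝ) 1 zero_le_one (x.1 : ℝ),
        projIcc (0 : ℝ) 1 zero_le_one (x.2 : ℝ)) = x) ∧ Module.finrank ℝ (ℝ × ℝ) = 2 := by
  refine ⟨by fun_prop, ?_, fun x => by simp only [projIcc_val], by simp⟩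
  exact ((LipschitzWith.projIcc _).uniformContinuous.comp uniformContinuous_fst).prodMk
    ((LipschitzWith.projIcc _).uniformContinuous.comp uniformContinuous_snd)

/-- **A null-homotopy can be pushed off a point with a Euclidean neighbourhood of dimension `≥ 3`**
(general position; the injectivity of `π₁(M ∖ p) → π₁(M)`): if the loop `p` avoids `i 0` and is
null-homotopic in the Hausdorff space `M`, where `i : E → M` is an open embedding of a real normed
space of dimension `> 2`, then it is null-homotopic through loops avoiding `i 0`
(`FundamentalGroupoid.exists_continuousMap_eqOn_forall_ne` with `K = [0,1]²`, keeping the boundary of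
the square fixed; compare `FundamentalGroupoid.isSimplyConnected_compl_singleton_of_isOpenEmbedding`).
Kosinski, *Differential Manifolds* (1993), VI.2; Hatcher (2002), proof of Prop. 1.14. [folklore] -/
theorem exists_homotopy_refl_forall_ne {E : Type*} [NormedAddCommGroup E] [NormedSpace ℝ E]
    [FiniteDimensional ℝ E] {M : Type*} [TopologicalSpace M] [T2Space M] {i : E → M}
    (hi : IsOpenEmbedding i) (h3 : 2 < Module.finrank ℝ E) {x : M} {p : Path x x}
    (hp : ∀ t, p t ≠ i 0) (H : p.Homotopy (Path.refl x)) :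
    ∃ G : p.Homotopy (Path.refl x), ∀ st, G st ≠ i 0 := by
  obtain ⟨hι, hπ, hπι, h2⟩ := retract_unitSquare''
  -- the boundary of the square
  let Z : Set (I × I) := {z | z.1 = 0} ∪ ({z | z.1 = 1} ∪ ({z | z.2 = 0} ∪ {z | z.2 = 1}))
  have hZ : IsClosed Z :=
    (isClosed_eq continuous_fst continuous_const).union
      ((isClosed_eq continuous_fst continuous_const).union
        ((isClosed_eq continuous_snd continuous_const).union
          (isClosed_eq continuous_snd continuous_const)))
  have hx : x ≠ i 0 := by simpa using hp 0
  have hHZ : ∀ z ∈ Z, H.toContinuousMap z ≠ i 0 := by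
    rintro ⟨s, t⟩ hz
    change H (s, t) ≠ i 0
    rcases hz with h | h | h | h <;> simp only [mem_setOf_eq] at h <;> subst h
    · rw [H.apply_zero]; exact hp t
    · rw [H.apply_one]; simpa using hx
    · rw [H.eq_fst s (by simp)]; exact hp 0
    · rw [H.eq_fst s (by simp)]; exact hp 1
  obtain ⟨g, hgZ, hg⟩ :=
    Literature.AlgebraicTopology.FundamentalGroupoid.exists_continuousMap_eqOn_forall_ne hι hπ hπι
      (h2.symm ▸ h3) hi H.toContinuousMap hZ hHZ
  have hgH : ∀ z ∈ Z, g z = H z := fun z hz => hgZ hz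
  refine ⟨{ toFun := g
            continuous_toFun := g.continuous
            map_zero_left := fun t => ?_
            map_one_left := fun t => ?_
            prop' := fun s t ht => ?_ }, fun st => hg st⟩
  · rw [hgH (0, t) (Or.inl rfl)]
    exact H.apply_zero t
  · rw [hgH (1, t) (Or.inr (Or.inl rfl))]
    exact H.apply_one t
  · simp only [ContinuousMap.coe_mk]
    have hst : (s, t) ∈ Z := by
      rcases ht with h | h
      · exact Or.inr (Or.inr (Or.inl h))
      · exact Or.inr (Or.inr (Or.inr h))
    rw [hgH (s, t) hst]
    exact H.eq_fst s ht

/-- Every point of the circle has a Euclidean neighbourhood `i : ℝ¹ ≅ U ∋ p = i 0` (a ball in a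
chart, reparametrised by `OpenPartialHomeomorph.univBall`; the case `M = 𝕊¹` of
`Homotopy.exists_isOpenEmbedding_apply_zero_eq`). [folklore] -/
theorem exists_isOpenEmbedding_apply_zero_eq_sphere_one (p : 𝕊 1) :
    ∃ i : EuclideanSpace ℝ (Fin 1) → 𝕊 1, IsOpenEmbedding i ∧ i 0 = p := by
  set c := chartAt (EuclideanSpace ℝ (Fin 1)) p with hc
  obtain ⟨r, hr, hball⟩ : ∃ r > 0, Metric.ball (c p) r ⊆ c.target :=
    Metric.isOpen_iff.1 c.open_target (c p) (c.map_source (mem_chart_source _ p))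
  set u := OpenPartialHomeomorph.univBall (c p) r with hu
  have hu_src : u.source = univ := OpenPartialHomeomorph.univBall_source (c p) r
  have hu_tgt : u.target = Metric.ball (c p) r := OpenPartialHomeomorph.univBall_target (c p) hr
  set e := u.trans c.symm with he
  have he_src : e.source = univ := by
    rw [he, OpenPartialHomeomorph.trans_source, hu_src, univ_inter, eq_univ_iff_forall]
    intro v
    show u v ∈ c.symm.source
    rw [c.symm_source]
    exact hball (hu_tgt ▸ u.map_source (hu_src.symm ▸ mem_univ v))
  refine ⟨e, e.to_isOpenEmbedding he_src, ?_⟩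
  show c.symm (u 0) = p
  rw [hu, OpenPartialHomeomorph.univBall_apply_zero]
  exact c.left_inv (mem_chart_source _ p)

variable {Y : Type*} [TopologicalSpace Y] {jB : solidTorus → Y}

/-- **The core point has a `3`-dimensional Euclidean neighbourhood** in the glued space:
`jB ∘ ((unit ball of ℝ²) × (chart ball of 𝕊¹))`. [folklore] -/
theorem exists_isOpenEmbedding_apply_zero_eq_corePt (hB : IsOpenEmbedding jB) :
    ∃ i : (𝔼 2) × EuclideanSpace ℝ (Fin 1) → Y, IsOpenEmbedding i ∧ i 0 = corePt jB := by
  obtain ⟨i₁, hi₁, hi₁0⟩ := exists_isOpenEmbedding_apply_zero_eq_sphere_one ptB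
  let e₂ := OpenPartialHomeomorph.univBall (0 : 𝔼 2) 1
  have he₂ : IsOpenEmbedding e₂ := e₂.to_isOpenEmbedding (OpenPartialHomeomorph.univBall_source _ _)
  have he₂ball : ∀ q : 𝔼 2, ‖e₂ q‖ < 1 := fun q => by
    have h := e₂.map_source (x := q) (by rw [OpenPartialHomeomorph.univBall_source]; exact mem_univ _)
    rw [OpenPartialHomeomorph.univBall_target _ one_pos] at h
    simpa using h
  let f : (𝔼 2) × EuclideanSpace ℝ (Fin 1) → (𝔼 2) × (𝕊 1) := Prod.map e₂ i₁
  have hf : IsOpenEmbedding f := he₂.prodMap hi₁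
  have hfO : ∀ x, f x ∈ (solidTorus : Set ((𝔼 2) × (𝕊 1))) := fun x => by
    rw [SetLike.mem_coe, mem_solidTorus_iff]
    exact he₂ball x.1
  refine ⟨jB ∘ (solidTorus : Set ((𝔼 2) × (𝕊 1))).codRestrict f hfO,
    hB.comp (Literature.AlgebraicTopology.FundamentalGroupoid.isOpenEmbedding_codRestrict hf hfO), ?_⟩
  change jB _ = jB _
  congr 1
  apply Subtype.ext
  change (e₂ 0, i₁ 0) = ((0 : 𝔼 2), ptB)
  rw [hi₁0, OpenPartialHomeomorph.univBall_apply_zero]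

end GeneralPosition

/-! ### The kernel of `π₁(S³ ∖ K) → π₁(Y)` and the longitude -/

section Main

variable {K : Knot} (ν : Knot.TubularNbhd K)
variable {Y : Type*} [TopologicalSpace Y] {jA : K.complement → Y} {jB : solidTorus → Y}

/-- `f_* [γ] = 1` iff `f ∘ γ` is null-homotopic (the bridge between Mathlib's
`FundamentalGroup.map` and homotopies; same statement as
`FundamentalGroup.map_fromPath_eq_one_iff` of `ZeroSurgeryHomotopyBallSlicePi1.lean`, not imported).
[folklore] -/
private theorem map_fromPath_eq_one_iff' {X Z : Type*} [TopologicalSpace X] [TopologicalSpace Z]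
    (f : C(X, Z)) {x : X} (γ : Path x x) :
    FundamentalGroup.map f x (FundamentalGroup.fromPath (Path.Homotopic.Quotient.mk γ)) = 1 ↔
      (γ.map f.continuous).Homotopic (Path.refl (f x)) := by
  rw [FundamentalGroup.one_def]
  change Path.Homotopic.Quotient.map (Path.Homotopic.Quotient.mk γ) f =
    Path.Homotopic.Quotient.mk (Path.refl (f x)) ↔ _
  rw [← Path.Homotopic.Quotient.mk_map]
  exact Quotient.eq

/-- **Kernel bound: `ker (jA_* : π₁(S³ ∖ K, p₀) → π₁(Y, jA p₀)) ≤ ⟪[longitude]⟫`.** A loop of the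
knot complement that dies in the glued space `Y` dies in `Y ∖ {c}` by general position
(`exists_homotopy_refl_forall_ne` with the Euclidean neighbourhood
`exists_isOpenEmbedding_apply_zero_eq_corePt` of the core point), hence its class lies in the normal
closure of the longitude (`fromPath_mem_normalClosure_longitude_of_homotopic_punctured`).
[cite: HatcherAT2002, Thm. 1.20] -/
theorem ker_map_le_normalClosure_longitude_of_glue [T2Space Y]
    (hR : ∀ a b, jA a = jB b ↔ surgeryRel ν a b) (hcov : range jA ∪ range jB = univ)
    (hA : IsOpenEmbedding jA) (hB : IsOpenEmbedding jB) :
    (FundamentalGroup.map (⟨jA, hA.continuous⟩ : C(K.complement, Y)) ν.basePoint).ker ≤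
      Subgroup.normalClosure
        {(FundamentalGroup.fromPath (Path.Homotopic.Quotient.mk ν.longitude) :
          FundamentalGroup K.complement ν.basePoint)} := by
  intro g hg
  obtain ⟨γ, hγ⟩ := Path.Homotopic.Quotient.mk_surjective (FundamentalGroup.toPath g)
  rw [show g = FundamentalGroup.fromPath (Path.Homotopic.Quotient.mk γ) from hγ.symm] at hg ⊢
  rw [MonoidHom.mem_ker, map_fromPath_eq_one_iff'] at hg
  obtain ⟨H⟩ := hg
  obtain ⟨i, hi, hi0⟩ := exists_isOpenEmbedding_apply_zero_eq_corePt hB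
  have hfin : 2 < Module.finrank ℝ ((𝔼 2) × EuclideanSpace ℝ (Fin 1)) := by
    rw [Module.finrank_prod, finrank_euclideanSpace_fin, finrank_euclideanSpace_fin]
    norm_num
  have hp : ∀ t, (γ.map (⟨jA, hA.continuous⟩ : C(K.complement, Y)).continuous) t ≠ i 0 := fun t => by
    rw [hi0]
    exact ν.jA_ne_corePt hR (γ t)
  obtain ⟨G, hG⟩ := exists_homotopy_refl_forall_ne hi hfin hp H
  have hG' : ∀ st, G st ∈ puncturedGlue jB := fun st h =>
    hG st ((mem_singleton_iff.1 h).trans hi0.symm)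
  refine ν.fromPath_mem_normalClosure_longitude_of_homotopic_punctured hR hcov hA hB γ
    ⟨{ toFun := fun st => ⟨G st, hG' st⟩
       continuous_toFun := G.continuous.subtype_mk _
       map_zero_left := fun t => ?_
       map_one_left := fun t => ?_
       prop' := fun s t ht => ?_ }⟩
  · apply Subtype.ext
    change G (0, t) = jA (γ t)
    exact G.apply_zero t
  · apply Subtype.ext
    change G (1, t) = jA ν.basePoint
    exact G.apply_one t
  · apply Subtype.ext
    change G (s, t) = jA (γ t)
    exact G.eq_fst s ht

/-- **The longitude dies in the surgered manifold**: `jA_* [longitude] = 1`, because `jA ∘ longitude`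
is the circle `t ↦ jB (½ (cos 2πt, sin 2πt), (1,0))` in the meridian disc `jB (D̊² × {(1,0)})` of the
new solid torus, which is convex. Rolfsen (1976), §9.F. [folklore] -/
theorem map_longitude_eq_one_of_glue (hR : ∀ a b, jA a = jB b ↔ surgeryRel ν a b)
    (hA : IsOpenEmbedding jA) (hB : IsOpenEmbedding jB) :
    FundamentalGroup.map (⟨jA, hA.continuous⟩ : C(K.complement, Y)) ν.basePoint
      (FundamentalGroup.fromPath (Path.Homotopic.Quotient.mk ν.longitude)) = 1 := by
  rw [map_fromPath_eq_one_iff']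
  -- the meridian disc of the new solid torus, a convex set, and the circle of radius `½` in it
  let D : Set (𝔼 2) := Metric.ball 0 1
  haveI : ContractibleSpace D := (convex_ball (0 : 𝔼 2) 1).contractibleSpace ⟨0, by simp⟩
  let disc : C(D, Y) :=
    ⟨fun q => jB (stPt (q : 𝔼 2) ptA (mem_ball_zero_iff.1 q.2)),
      hB.continuous.comp (Continuous.subtype_mk (continuous_subtype_val.prodMk continuous_const) _)⟩
  have hhalf : ∀ s : ℝ, (1 / 2 : ℝ) • ((circlePt s : 𝕊 1) : 𝔼 2) ∈ D := fun s =>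
    mem_ball_zero_iff.2 (norm_smul_coe_lt_one _ ⟨by norm_num, by norm_num⟩)
  have hq₀ : framingBaseVector ∈ D :=
    mem_ball_zero_iff.2 (norm_smul_coe_lt_one (circlePoint 0) ⟨by norm_num, by norm_num⟩)
  let q₀ : D := ⟨framingBaseVector, hq₀⟩
  let cfun : I → D := fun t => ⟨(1 / 2 : ℝ) • ((circlePt (t : ℝ) : 𝕊 1) : 𝔼 2), hhalf t⟩
  have hcfun : Continuous cfun := by
    refine Continuous.subtype_mk ?_ _
    show Continuous fun t : I => (1 / 2 : ℝ) • ((circlePt (t : ℝ) : 𝕊 1) : 𝔼 2)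
    refine (continuous_const (y := (1 / 2 : ℝ))).smul ?_
    exact continuous_subtype_val.comp' (continuous_circlePt.comp' continuous_subtype_val)
  let circ : Path q₀ q₀ :=
    { toFun := cfun
      continuous_toFun := hcfun
      source' := by
        apply Subtype.ext
        change (1 / 2 : ℝ) • ((circlePt ((0 : I) : ℝ) : 𝕊 1) : 𝔼 2) = framingBaseVector
        rw [Set.Icc.coe_zero, circlePt_eq_circlePoint, mul_zero]; rfl
      target' := by
        apply Subtype.ext
        change (1 / 2 : ℝ) • ((circlePt ((1 : I) : ℝ) : 𝕊 1) : 𝔼 2) = framingBaseVector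
        rw [Set.Icc.coe_one, circlePt_one]; rfl }
  have hdq : disc q₀ = jA ν.basePoint := by
    change jB (stPt framingBaseVector ptA _) = jA ν.basePoint
    rw [ν.jA_basePoint hR]
  -- `jA ∘ longitude = disc ∘ circ`
  have hpt : ∀ t, (ν.longitude.map (⟨jA, hA.continuous⟩ : C(K.complement, Y)).continuous) t =
      disc (circ t) := fun t => by
    change jA (ν.longitude t) = jB (stPt ((1 / 2 : ℝ) • ((circlePt (t : ℝ) : 𝕊 1) : 𝔼 2)) ptA _)
    have h := ν.glue_apply hR (circlePt (t : ℝ)) ptA (t := 1 / 2) ⟨by norm_num, by norm_num⟩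
    rw [← h]
    congr 1
    apply Subtype.ext
    rw [coe_longitude_apply]
    change ν (circlePoint (2 * π * t), framingBaseVector) =
      ν (circlePt (t : ℝ), (1 / 2 : ℝ) • ((ptA : 𝕊 1) : 𝔼 2))
    rw [circlePt_eq_circlePoint, show framingBaseVector = (1 / 2 : ℝ) • ((circlePoint 0 : 𝕊 1) : 𝔼 2)
      from rfl, circlePoint_zero_eq_ptA]
  have e := FundamentalGroup.mapOfEq_fromPath_eq disc hdq circ
    (ν.longitude.map (⟨jA, hA.continuous⟩ : C(K.complement, Y)).continuous) hpt
  have hcirc : Path.Homotopic.Quotient.mk circ = Path.Homotopic.Quotient.mk (Path.refl q₀) :=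
    Path.Homotopic.Quotient.eq.2 (SimplyConnectedSpace.paths_homotopic _ _)
  have key : FundamentalGroup.fromPath (Path.Homotopic.Quotient.mk
      (ν.longitude.map (⟨jA, hA.continuous⟩ : C(K.complement, Y)).continuous)) =
      (1 : FundamentalGroup Y (jA ν.basePoint)) := by
    rw [← e, hcirc]
    exact map_one _
  rw [FundamentalGroup.one_def] at key
  rw [← Path.Homotopic.Quotient.eq]
  exact key

/-- **`ker jA_* = ⟪[longitude]⟫`** for the surgery gluing (`ker_map_le_normalClosure_longitude_of_glue`
and `map_longitude_eq_one_of_glue`). [cite: HatcherAT2002, Thm. 1.20] -/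
theorem ker_map_eq_normalClosure_longitude_of_glue [T2Space Y]
    (hR : ∀ a b, jA a = jB b ↔ surgeryRel ν a b) (hcov : range jA ∪ range jB = univ)
    (hA : IsOpenEmbedding jA) (hB : IsOpenEmbedding jB) :
    (FundamentalGroup.map (⟨jA, hA.continuous⟩ : C(K.complement, Y)) ν.basePoint).ker =
      Subgroup.normalClosure
        {(FundamentalGroup.fromPath (Path.Homotopic.Quotient.mk ν.longitude) :
          FundamentalGroup K.complement ν.basePoint)} := by
  refine le_antisymm (ν.ker_map_le_normalClosure_longitude_of_glue hR hcov hA hB) ?_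
  refine Subgroup.normalClosure_le_normal ?_
  rintro _ rfl
  exact ν.map_longitude_eq_one_of_glue hR hA hB

/-! ### Surjectivity of `π₁(S³ ∖ K) → π₁(Y)` -/

/-- The circle is path connected (it is the image of `ℝ` under `θ ↦ (cos 2πθ, sin 2πθ)`).
[folklore] -/
theorem isPathConnected_univ_sphere_one : IsPathConnected (univ : Set (𝕊 1)) := by
  have : range circlePt = (univ : Set (𝕊 1)) := eq_univ_of_forall fun u => ⟨angB u, circlePt_angB u⟩
  rw [← this]
  exact isPathConnected_range continuous_circlePt

/-- The open solid torus is path connected. [folklore] -/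
theorem isPathConnected_univ_solidTorus : IsPathConnected (univ : Set solidTorus) := by
  haveI : PathConnectedSpace (Metric.ball (0 : 𝔼 2) 1) :=
    (isPathConnected_iff_pathConnectedSpace).1
      ((convex_ball (0 : 𝔼 2) 1).isPathConnected ⟨0, by simp⟩)
  haveI : PathConnectedSpace (𝕊 1) := pathConnectedSpace_iff_univ.2 isPathConnected_univ_sphere_one
  let F : (Metric.ball (0 : 𝔼 2) 1) × (𝕊 1) → solidTorus := fun x =>
    stPt (x.1 : 𝔼 2) x.2 (mem_ball_zero_iff.1 x.1.2)
  have hF : Continuous F :=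
    ((continuous_subtype_val.comp continuous_fst).prodMk continuous_snd).subtype_mk _
  have hrange : range F = univ := eq_univ_of_forall fun b =>
    ⟨(⟨(b : (𝔼 2) × (𝕊 1)).1, mem_ball_zero_iff.2 ((mem_solidTorus_iff _).1 b.2)⟩,
      (b : (𝔼 2) × (𝕊 1)).2), stPt_eta b⟩
  rw [← hrange]
  exact isPathConnected_range hF

/-- Convex combinations of points of the open unit disc lie in the open unit disc. [folklore] -/
theorem norm_combo_lt_one {p q : 𝔼 2} (hp : ‖p‖ < 1) (hq : ‖q‖ < 1) (s : I) :
    ‖(1 - (s : ℝ)) • p + (s : ℝ) • q‖ < 1 := by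
  have h := convex_ball (0 : 𝔼 2) 1 (mem_ball_zero_iff.2 hp) (mem_ball_zero_iff.2 hq)
    (sub_nonneg.2 s.2.2) s.2.1 (by ring)
  exact mem_ball_zero_iff.1 h

/-- Mathlib's `FundamentalGroup.map f x` and `FundamentalGroup.mapOfEq f rfl` agree (as in
`InclHomTransport.lean`, not imported). [folklore] -/
private theorem map_eq_mapOfEq' {X Z : Type*} [TopologicalSpace X] [TopologicalSpace Z]
    (f : C(X, Z)) (x : X) :
    FundamentalGroup.map f x = FundamentalGroup.mapOfEq f (rfl : f x = f x) := by
  ext p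
  induction p using Quotient.ind with
  | _ γ => rw [FundamentalGroup.mapOfEq_apply]; rfl

/-- **Loops of the new solid torus retract into the knot complement.** Every loop of `Y` at
`x₀ = jA p₀` inside `jB (D̊² × 𝕊¹)` is homotopic, fixing `x₀`, to a loop inside
`jB ({½(1,0)} × 𝕊¹) ⊆ jA (S³ ∖ K)`, by the convex homotopy
`(p, v) ↦ ((1 - s) p + s ½(1,0), v)`; hence the image of `π₁(jB (D̊² × 𝕊¹))` in `π₁(Y, x₀)` is
contained in that of `π₁(jA (S³ ∖ K))`. [folklore] -/
theorem range_inclHom_jB_le (hR : ∀ a b, jA a = jB b ↔ surgeryRel ν a b)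
    (hB : IsOpenEmbedding jB) (hxU : jA ν.basePoint ∈ range jA) (hxT : jA ν.basePoint ∈ range jB) :
    Set.range (VanKampen.inclHom (range jB) (jA ν.basePoint) hxT) ⊆
      Set.range (VanKampen.inclHom (range jA) (jA ν.basePoint) hxU) := by
  rintro _ ⟨a, rfl⟩
  obtain ⟨δT, rfl⟩ : ∃ δT : Path (⟨jA ν.basePoint, hxT⟩ : range jB) ⟨jA ν.basePoint, hxT⟩,
      FundamentalGroup.fromPath (Path.Homotopic.Quotient.mk δT) = a :=
    Path.Homotopic.Quotient.mk_surjective (FundamentalGroup.toPath a)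
  -- pull the loop back to the solid torus
  let eB := hB.isEmbedding.toHomeomorph
  let β : I → solidTorus := fun t => eB.symm (δT t)
  have hβ : Continuous β := eB.symm.continuous.comp δT.continuous
  have hjβ : ∀ t, jB (β t) = ((δT t : range jB) : Y) := fun t => by
    have h := congrArg Subtype.val (eB.apply_symm_apply (δT t))
    rwa [IsEmbedding.toHomeomorph_apply_coe] at h
  -- the glued base point of the solid torus
  have hfb : ‖framingBaseVector‖ < 1 := by
    rw [show framingBaseVector = (1 / 2 : ℝ) • ((circlePoint 0 : 𝕊 1) : 𝔼 2) from rfl]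
    exact norm_smul_coe_lt_one _ ⟨by norm_num, by norm_num⟩
  let b₁ : solidTorus := stPt framingBaseVector ptA hfb
  have hb₁ : jA ν.basePoint = jB b₁ := ν.jA_basePoint hR
  have hβend : ∀ t, ((δT t : range jB) : Y) = jA ν.basePoint → β t = b₁ := fun t ht => by
    change eB.symm (δT t) = b₁
    have : δT t = ⟨jB b₁, b₁, rfl⟩ := Subtype.ext (ht.trans hb₁)
    rw [this]
    exact IsEmbedding.toHomeomorph_symm_apply _ _
  have hβ0 : β 0 = b₁ := hβend 0 (by rw [δT.source])
  have hβ1 : β 1 = b₁ := hβend 1 (by rw [δT.target])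
  -- coordinates
  let p : I → 𝔼 2 := fun t => ((β t : solidTorus) : (𝔼 2) × (𝕊 1)).1
  let v : I → 𝕊 1 := fun t => ((β t : solidTorus) : (𝔼 2) × (𝕊 1)).2
  have hp : Continuous p := continuous_fst.comp (continuous_subtype_val.comp hβ)
  have hv : Continuous v := continuous_snd.comp (continuous_subtype_val.comp hβ)
  have hplt : ∀ t, ‖p t‖ < 1 := fun t => (mem_solidTorus_iff _).1 (β t).2
  have hp0 : p 0 = framingBaseVector := by change ((β 0 : solidTorus) : (𝔼 2) × (𝕊 1)).1 = _; rw [hβ0]; rfl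
  have hp1 : p 1 = framingBaseVector := by change ((β 1 : solidTorus) : (𝔼 2) × (𝕊 1)).1 = _; rw [hβ1]; rfl
  have hv0 : v 0 = ptA := by change ((β 0 : solidTorus) : (𝔼 2) × (𝕊 1)).2 = _; rw [hβ0]; rfl
  have hv1 : v 1 = ptA := by change ((β 1 : solidTorus) : (𝔼 2) × (𝕊 1)).2 = _; rw [hβ1]; rfl
  have hβpv : ∀ t, β t = stPt (p t) (v t) (hplt t) := fun t => (stPt_eta (β t)).symm
  -- the retracted loop, inside `jB ({½(1,0)} × 𝕊¹) ⊆ range jA`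
  let ρ : Path (jA ν.basePoint) (jA ν.basePoint) :=
    { toFun := fun t => jB (stPt framingBaseVector (v t) hfb)
      continuous_toFun := hB.continuous.comp ((continuous_const.prodMk hv).subtype_mk _)
      source' := by rw [hb₁]; congr 1; exact Subtype.ext (Prod.ext rfl hv0)
      target' := by rw [hb₁]; congr 1; exact Subtype.ext (Prod.ext rfl hv1) }
  have hρU : ∀ t, ρ t ∈ range jA := fun t =>
    ν.jB_mem_range_jA hR _ framingBaseVector_ne_zero
  -- the convex homotopy from `δT` to `ρ`
  let Fmap : I × I → Y := fun st =>
    jB (stPt ((1 - (st.1 : ℝ)) • p st.2 + (st.1 : ℝ) • framingBaseVector) (v st.2)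
      (norm_combo_lt_one (hplt st.2) hfb st.1))
  have hFmap : Continuous Fmap := by
    refine hB.continuous.comp (Continuous.subtype_mk (Continuous.prodMk ?_ (hv.comp continuous_snd)) _)
    exact (((continuous_const.sub (continuous_subtype_val.comp continuous_fst)).smul
      (hp.comp continuous_snd)).add ((continuous_subtype_val.comp continuous_fst).smul continuous_const))
  have hF0 : ∀ t, Fmap (0, t) = ((δT t : range jB) : Y) := fun t => by
    rw [← hjβ t, hβpv t]
    change jB _ = jB _
    congr 1
    apply Subtype.ext
    change ((1 - ((0 : I) : ℝ)) • p t + ((0 : I) : ℝ) • framingBaseVector, v t) = (p t, v t)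
    rw [Set.Icc.coe_zero, sub_zero, one_smul, zero_smul, add_zero]
  have hF1 : ∀ t, Fmap (1, t) = ρ t := fun t => by
    change jB _ = jB _
    congr 1
    apply Subtype.ext
    change ((1 - ((1 : I) : ℝ)) • p t + ((1 : I) : ℝ) • framingBaseVector, v t) = (framingBaseVector, v t)
    rw [Set.Icc.coe_one, sub_self, zero_smul, one_smul, zero_add]
  have hFend : ∀ (s t : I), p t = framingBaseVector → Fmap (s, t) = jB (stPt framingBaseVector (v t) hfb) :=
    fun s t ht => by
    change jB _ = jB _
    congr 1
    apply Subtype.ext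
    change ((1 - (s : ℝ)) • p t + (s : ℝ) • framingBaseVector, v t) = (framingBaseVector, v t)
    rw [ht, ← add_smul, sub_add_cancel, one_smul]
  let F : Path.Homotopy (δT.map continuous_subtype_val) ρ :=
    { toFun := Fmap
      continuous_toFun := hFmap
      map_zero_left := hF0
      map_one_left := hF1
      prop' := fun s t ht => by
        change Fmap (s, t) = ((δT t : range jB) : Y)
        have ht' : t = 0 ∨ t = 1 := by simpa using ht
        rcases ht' with rfl | rfl
        · rw [hFend s 0 hp0, δT.source]
          change _ = jA ν.basePoint
          rw [hb₁]
          congr 1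
          exact Subtype.ext (Prod.ext rfl hv0)
        · rw [hFend s 1 hp1, δT.target]
          change _ = jA ν.basePoint
          rw [hb₁]
          congr 1
          exact Subtype.ext (Prod.ext rfl hv1) }
  have hhom : Path.Homotopic.Quotient.mk (δT.map continuous_subtype_val) =
      Path.Homotopic.Quotient.mk ρ := Path.Homotopic.Quotient.eq.2 ⟨F⟩
  refine ⟨FundamentalGroup.fromPath (Path.Homotopic.Quotient.mk (VanKampen.liftPath (range jA) ρ hρU)), ?_⟩
  rw [VanKampen.inclHom_fromPath_liftPath, VanKampen.inclHom_fromPath, hhom]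

/-- **Surjectivity: `jA_* : π₁(S³ ∖ K, p₀) → π₁(Y, jA p₀)` is onto.** By Hatcher's Lemma 1.15
(`VanKampen.closure_range_inclHom_union_eq_top`) for the cover `Y = jA (S³ ∖ K) ∪ jB (D̊² × 𝕊¹)`,
whose overlap `jB ((D̊² ∖ 0) × 𝕊¹)` is path connected, `π₁(Y, x₀)` is generated by the images of the
two pieces, and the image of the solid torus is contained in that of the knot complement
(`range_inclHom_jB_le`). [cite: HatcherAT2002, Lemma 1.15] -/
theorem map_surjective_of_glue (hR : ∀ a b, jA a = jB b ↔ surgeryRel ν a b)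
    (hcov : range jA ∪ range jB = univ) (hA : IsOpenEmbedding jA) (hB : IsOpenEmbedding jB) :
    Function.Surjective
      (FundamentalGroup.map (⟨jA, hA.continuous⟩ : C(K.complement, Y)) ν.basePoint) := by
  let x₀ : Y := jA ν.basePoint
  have hxU : x₀ ∈ range jA := ⟨_, rfl⟩
  have hxT : x₀ ∈ range jB := ⟨_, (ν.jA_basePoint hR).symm⟩
  haveI : PathConnectedSpace K.complement := ν.pathConnectedSpace_complement
  haveI : PathConnectedSpace solidTorus := pathConnectedSpace_iff_univ.2 isPathConnected_univ_solidTorus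
  have hUpc : IsPathConnected (range jA) := isPathConnected_range hA.continuous
  have hTpc : IsPathConnected (range jB) := isPathConnected_range hB.continuous
  have hmeet : IsPathConnected (range jA ∩ range jB) := by
    rw [ν.range_jA_inter_range_jB hR]
    refine IsPathConnected.image ?_ hB.continuous
    have h := isPathConnected_solidTorus_setOf isPathConnected_univ_sphere_one
    convert h using 1
    ext b
    simp
  have hgen := VanKampen.closure_range_inclHom_union_eq_top hA.isOpen_range hB.isOpen_range hcov
    hxU hxT hUpc hTpc hmeet
  rw [Set.union_eq_self_of_subset_right (ν.range_inclHom_jB_le hR hB hxU hxT),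
    ← MonoidHom.coe_range, Subgroup.closure_eq] at hgen
  -- every class of `π₁(Y, x₀)` is the image of a loop of `jA (S³ ∖ K)`, hence of `S³ ∖ K`
  intro g
  have hg : g ∈ (VanKampen.inclHom (range jA) x₀ hxU).range := by rw [hgen]; exact Subgroup.mem_top g
  obtain ⟨a, rfl⟩ := hg
  obtain ⟨δU, rfl⟩ : ∃ δU : Path (⟨x₀, hxU⟩ : range jA) ⟨x₀, hxU⟩,
      FundamentalGroup.fromPath (Path.Homotopic.Quotient.mk δU) = a :=
    Path.Homotopic.Quotient.mk_surjective (FundamentalGroup.toPath a)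
  let eA := hA.isEmbedding.toHomeomorph
  have hend : eA.symm ⟨x₀, hxU⟩ = ν.basePoint := IsEmbedding.toHomeomorph_symm_apply _ _
  let β' : Path ν.basePoint ν.basePoint :=
    (δU.map eA.symm.continuous).cast hend.symm hend.symm
  refine ⟨FundamentalGroup.fromPath (Path.Homotopic.Quotient.mk β'), ?_⟩
  have hpt : ∀ t, (δU.map continuous_subtype_val) t =
      (⟨jA, hA.continuous⟩ : C(K.complement, Y)) (β' t) := fun t => by
    change ((δU t : range jA) : Y) = jA (eA.symm (δU t))
    have h := congrArg Subtype.val (eA.apply_symm_apply (δU t))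
    rw [IsEmbedding.toHomeomorph_apply_coe] at h
    exact h.symm
  rw [map_eq_mapOfEq', FundamentalGroup.mapOfEq_fromPath_eq _ rfl β' (δU.map continuous_subtype_val) hpt,
    VanKampen.inclHom_fromPath]

/-- **`π₁(Y, jA p₀) ≃* π₁(S³ ∖ K, p₀) ⧸ ⟪[longitude]⟫`**: the fundamental group of the surgery
gluing is the knot group modulo the normal closure of the framed longitude (first isomorphism
theorem applied to `map_surjective_of_glue` and `ker_map_eq_normalClosure_longitude_of_glue`).
[folklore] -/
theorem nonempty_mulEquiv_quotient_of_glue [T2Space Y]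
    (hR : ∀ a b, jA a = jB b ↔ surgeryRel ν a b) (hcov : range jA ∪ range jB = univ)
    (hA : IsOpenEmbedding jA) (hB : IsOpenEmbedding jB) :
    Nonempty (FundamentalGroup Y (jA ν.basePoint) ≃*
      FundamentalGroup K.complement ν.basePoint ⧸ Subgroup.normalClosure
        {(FundamentalGroup.fromPath (Path.Homotopic.Quotient.mk ν.longitude) :
          FundamentalGroup K.complement ν.basePoint)}) := by
  let f := FundamentalGroup.map (⟨jA, hA.continuous⟩ : C(K.complement, Y)) ν.basePoint
  have hker := ν.ker_map_eq_normalClosure_longitude_of_glue hR hcov hA hB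
  exact ⟨((QuotientGroup.quotientMulEquivOfEq hker.symm).trans
    (QuotientGroup.quotientKerEquivOfSurjective f (ν.map_surjective_of_glue hR hcov hA hB))).symm⟩

end Main

end Knot.TubularNbhd

/-! ### The `IsIntegralSurgery` form -/

section Surgery

variable {EY HY : Type*} [NormedAddCommGroup EY] [NormedSpace ℝ EY] [TopologicalSpace HY]
  {IY : ModelWithCorners ℝ EY HY} {Y : Type*} [TopologicalSpace Y] [ChartedSpace HY Y]

/-- **The fundamental group of an integral Dehn surgery.** If the Hausdorff manifold `Y` is
`m`-surgery on the knot `K` (`IsIntegralSurgery IY Y K m`, `DehnSurgery.lean`), then for some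
oriented tubular neighbourhood `ν` of `K` of framing `m` and the (open, smooth) embedding
`jA : S³ ∖ K → Y` of the gluing, the induced map `jA_* : π₁(S³ ∖ K, p₀) → π₁(Y, jA p₀)` is
**surjective with kernel the normal closure of the class of the `m`-framed longitude
`ν.longitude`**. (Van Kampen; the tree's relational gluing unfolded into
`Knot.TubularNbhd.map_surjective_of_glue` and
`Knot.TubularNbhd.ker_map_eq_normalClosure_longitude_of_glue`.) Rolfsen (1976), §9.F–G;
Gompf–Stipsicz (1999), §5.3. [folklore] -/
theorem IsIntegralSurgery.exists_map_surjective_and_ker_eq [T2Space Y] {K : Knot} {m : ℤ}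
    (h : IsIntegralSurgery IY Y K m) :
    ∃ (ν : Knot.TubularNbhd K) (jA : C(K.complement, Y)), ν.HasFraming m ∧ IsOpenEmbedding jA ∧
      Function.Surjective (FundamentalGroup.map jA ν.basePoint) ∧
      (FundamentalGroup.map jA ν.basePoint).ker = Subgroup.normalClosure
        {(FundamentalGroup.fromPath (Path.Homotopic.Quotient.mk ν.longitude) :
          FundamentalGroup K.complement ν.basePoint)} := by
  obtain ⟨ν, hν, jA, jB, hA, hAo, hB, hBo, hcov, hR⟩ := h
  have hA' : IsOpenEmbedding jA := ⟨hA.isEmbedding, hAo⟩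
  have hB' : IsOpenEmbedding jB := ⟨hB.isEmbedding, hBo⟩
  exact ⟨ν, ⟨jA, hA'.continuous⟩, hν, hA', ν.map_surjective_of_glue hR hcov hA' hB',
    ν.ker_map_eq_normalClosure_longitude_of_glue hR hcov hA' hB'⟩

/-- **`π₁` of an integral Dehn surgery is the knot group modulo the framed longitude**: if the
Hausdorff manifold `Y` is `m`-surgery on `K`, then for some tubular neighbourhood `ν` of framing `m`
and some base point, `π₁(Y, y₀) ≃* π₁(S³ ∖ K, p₀) ⧸ ⟪[ν.longitude]⟫`. Rolfsen (1976), §9.F–G;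
Gompf–Stipsicz (1999), §5.3; Hatcher (2002), Thm. 1.20 / Prop. 1.26. [folklore] -/
theorem IsIntegralSurgery.exists_mulEquiv_quotient_normalClosure_longitude [T2Space Y] {K : Knot}
    {m : ℤ} (h : IsIntegralSurgery IY Y K m) :
    ∃ (ν : Knot.TubularNbhd K) (y₀ : Y), ν.HasFraming m ∧
      Nonempty (FundamentalGroup Y y₀ ≃*
        FundamentalGroup K.complement ν.basePoint ⧸ Subgroup.normalClosure
          {(FundamentalGroup.fromPath (Path.Homotopic.Quotient.mk ν.longitude) :
            FundamentalGroup K.complement ν.basePoint)}) := by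
  obtain ⟨ν, hν, jA, jB, hA, hAo, hB, hBo, hcov, hR⟩ := h
  have hA' : IsOpenEmbedding jA := ⟨hA.isEmbedding, hAo⟩
  have hB' : IsOpenEmbedding jB := ⟨hB.isEmbedding, hBo⟩
  exact ⟨ν, jA ν.basePoint, hν, ν.nonempty_mulEquiv_quotient_of_glue hR hcov hA' hB'⟩

end Surgery

end Literature.Topology.FourManifolds
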